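import Mathlib
import HarnessLib
import Literature.Computability.AlgebraicComplexity.TensorRestrictionRank
import Literature.Computability.AlgebraicComplexity.CoppersmithWinograd1990Proofs
import Literature.Computability.AlgebraicComplexity.BigCwFourthOmega
import Summits.MatrixMultiplication.Statement
import Summits.MatrixMultiplication.MatrixMultiplication.Theses.OutsiderSandwich
import Summits.MatrixMultiplication.MatrixMultiplication.Theorems.OutsiderSandwichLaserMergeCore

/-!
# OutsiderSandwichLaserMerge, part 2/2 — the laser-merge rungs BY NAME (items 28622, 28972, 28973)

Last file of the landing chain `OutsiderSandwichLaserMergeCore` → `OutsiderSandwichLaserMerge` for route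
`route-MatrixMultiplication-OutsiderSandwich` (rev 3, commit a0cee665cb6e), aside items
`stmt-MatrixMultiplication-28622` `CwTwoRateLaserMerge` (+ 28972 `CwTwoRateLeGall`, 28973
`CwTwoRateTwoPointSeven`, its hypothesis-free instances):

  `∀ c, 0 ≤ c → c < 2 ^ (2/3 + 2/ω · (log₂ 3 − 2/3)) → ∀ N₀, ∃ N ≥ N₀, ∃ m,
      cw₂^{⊠N} ≥ ⟨m,m,m⟩ ∧ c^N ≤ m²`.

Proved here BY NAME / hypothesis-free (all sorry-free, no new axioms):
* `cwTwoRateLaserMerge_holds : Theses.OutsiderSandwich.CwTwoRateLaserMerge` (the item, from part 1);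
* `cwTwoRate_of_omega_le` — the same rung for `c < 2^{ℓ(ω')}` from any upper bound `ω ≤ ω'`;
* `cwTwoRate_leGall` / `cwTwoRateLeGall_holds : Theses.OutsiderSandwich.CwTwoRateLeGall` (item 28972) — with
  the tree's kernel bound `LeGall2014_cw4_omega_le : ω ≤ 2.37295`, the rung for every
  `c < 2^{ℓ(2.37295)} = 2.71441…` with NO hypothesis;
* `cwTwoRate_of_le_twoPointSeven` / `cwTwoRateTwoPointSeven_holds : Theses.OutsiderSandwich.CwTwoRateTwoPointSeven`
  (item 28973) — the decimal instance `c ≤ 2.7` (the route's hypothesis-free kernel rung moves from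
  `4^{log₆ 3} = 2.3397`, item 28620 of the companion chain `OutsiderSandwichHalfMM`, to `2.7`).

The summit `ω = 2` is equivalent on this route to the rate for every `c < 3` (`CwTwoMMPerfect`); `ℓ(2) = log₂ 3`
recovers exactly that, so this chain is the `ω`-monotone interpolation between the print rung and TOP.

Landing (lander / prover seat, after part 1):
`ledger propose --kind proof --target Summits/MatrixMultiplication/MatrixMultiplication/Theorems/OutsiderSandwichLaserMerge.lean
   --file OutsiderSandwichLaserMerge.lean --workitem stmt-MatrixMultiplication-28622` (closes 28972 and 28973 by
type match as well); optional stronger T3 witness for the tribunal re-check: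
`--witness Summit.MatrixMultiplication.MatrixMultiplication.Theorems.OutsiderSandwichLaserMerge.cwTwoRateTwoPointSeven_holds`.

References: [BurgisserClausenShokrollahi1997, Thm. 15.41], [LeGall2014, Table 2], [Blaser2013, §8].
-/

set_option linter.dupNamespace false -- `MatrixMultiplication.MatrixMultiplication` (summit = problem, D-0017)

namespace Summit.MatrixMultiplication.MatrixMultiplication.Theorems.OutsiderSandwichLaserMerge

open scoped BigOperators
open Literature.Computability.AlgebraicComplexity

/-- **Item `CwTwoRateLaserMerge` (stmt-MatrixMultiplication-28622), BY NAME**: the laser-merge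
rung `CwTwoRate c` for every `0 ≤ c < 2^{2/3 + (2/ω)(log₂ 3 − 2/3)}`.
[cite: BurgisserClausenShokrollahi1997, Thm. 15.41 (p. 381) and §15.5 (p. 425)] -/
theorem cwTwoRateLaserMerge_holds :
    Summit.MatrixMultiplication.MatrixMultiplication.Theses.OutsiderSandwich.CwTwoRateLaserMerge := by
  intro c hc0 hc N₀
  have hω0 : 0 < omega ℂ := by linarith [omega_two_le ℂ]
  have hc' : max c 1 < (2 : ℝ) ^ (2 / 3 + 2 / omega ℂ * (Real.logb 2 3 - 2 / 3)) :=
    max_lt hc (one_lt_two_rpow_ell hω0)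
  obtain ⟨N, hN, n, hres, hle⟩ := cwTwoRate_laserMerge_of_one_le (le_max_right c 1) hc' N₀
  exact ⟨N, hN, n, hres, (pow_le_pow_left₀ hc0 (le_max_left c 1) N).trans hle⟩

/-! ## Hypothesis-free consequences -/

/-- **The rung from any upper bound `ω ≤ ω'`**: `CwTwoRate c` for every `0 ≤ c < 2^{ℓ(ω')}`
(`ℓ` is antitone in `ω`). [this route, g5] -/
theorem cwTwoRate_of_omega_le {ω' : ℝ} (hω' : omega ℂ ≤ ω') {c : ℝ} (hc0 : 0 ≤ c)
    (hc : c < (2 : ℝ) ^ (2 / 3 + 2 / ω' * (Real.logb 2 3 - 2 / 3))) (N₀ : ℕ) :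
    ∃ N : ℕ, N₀ ≤ N ∧ ∃ n : ℕ,
      TensorRestrictsTo (kroneckerPow (cwTensor ℂ 2) N) (matMulTensor ℂ n n n) ∧
        c ^ N ≤ (n : ℝ) ^ 2 := by
  have hω0 : 0 < omega ℂ := by linarith [omega_two_le ℂ]
  have h1 : 1 < Real.logb 2 3 := by
    rw [Real.lt_logb_iff_rpow_lt (by norm_num) (by norm_num), Real.rpow_one]; norm_num
  have hpos : 0 < Real.logb 2 3 - 2 / 3 := by linarith
  have hdiv : 2 / ω' ≤ 2 / omega ℂ := div_le_div_of_nonneg_left (by norm_num) hω0 hω'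
  have hexp : 2 / 3 + 2 / ω' * (Real.logb 2 3 - 2 / 3) ≤
      2 / 3 + 2 / omega ℂ * (Real.logb 2 3 - 2 / 3) := by
    nlinarith
  exact cwTwoRateLaserMerge_holds c hc0
    (hc.trans_le (Real.rpow_le_rpow_of_exponent_le one_le_two hexp)) N₀

/-- **Hypothesis-free laser-merge rung (Le Gall's kernel bound)**: `CwTwoRate c` for every
`0 ≤ c < 2^{2/3 + (2/2.37295)(log₂ 3 − 2/3)} = 2.71441…`, from the tree theorem
`LeGall2014_cw4_omega_le : ω ≤ 2.37295`. [cite: LeGall2014, Table 2] -/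
theorem cwTwoRate_leGall {c : ℝ} (hc0 : 0 ≤ c)
    (hc : c < (2 : ℝ) ^ (2 / 3 + 2 / (2.37295 : ℝ) * (Real.logb 2 3 - 2 / 3))) (N₀ : ℕ) :
    ∃ N : ℕ, N₀ ≤ N ∧ ∃ n : ℕ,
      TensorRestrictsTo (kroneckerPow (cwTensor ℂ 2) N) (matMulTensor ℂ n n n) ∧
        c ^ N ≤ (n : ℝ) ^ 2 :=
  cwTwoRate_of_omega_le (LeGall2014_cw4_omega_le ℂ) hc0 hc N₀

/-- `log₂ 3 ≥ 1.58` (`2^79 ≤ 3^50`). [folklore] -/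
theorem logb_two_three_ge : (1.58 : ℝ) ≤ Real.logb 2 3 := by
  rw [Real.le_logb_iff_rpow_le (by norm_num) (by norm_num)]
  have h50 : ((2 : ℝ) ^ (1.58 : ℝ)) ^ (50 : ℕ) ≤ (3 : ℝ) ^ (50 : ℕ) := by
    rw [← Real.rpow_natCast ((2 : ℝ) ^ (1.58 : ℝ)) 50, ← Real.rpow_mul (by norm_num),
      show (1.58 : ℝ) * ((50 : ℕ) : ℝ) = ((79 : ℕ) : ℝ) by norm_num, Real.rpow_natCast]
    norm_num
  exact (pow_le_pow_iff_left₀ (Real.rpow_nonneg (by norm_num) _) (by norm_num)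
    (by norm_num : (50 : ℕ) ≠ 0)).1 h50

/-- `2.7 < 2^{33/23}` (`2.7^{23} < 2^{33}`). [folklore] -/
theorem twoPointSeven_lt_two_rpow : (2.7 : ℝ) < (2 : ℝ) ^ ((33 : ℝ) / 23) := by
  have h23 : (2.7 : ℝ) ^ (23 : ℕ) < ((2 : ℝ) ^ ((33 : ℝ) / 23)) ^ (23 : ℕ) := by
    rw [← Real.rpow_natCast ((2 : ℝ) ^ ((33 : ℝ) / 23)) 23, ← Real.rpow_mul (by norm_num),
      show (33 : ℝ) / 23 * ((23 : ℕ) : ℝ) = ((33 : ℕ) : ℝ) by norm_num, Real.rpow_natCast]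
    norm_num
  exact lt_of_pow_lt_pow_left₀ 23 (Real.rpow_nonneg (by norm_num) _) h23

/-- **The decimal rung `2.7`, hypothesis-free**: `CwTwoRate c` for every `0 ≤ c ≤ 2.7`
(`2.7 < 2^{33/23} ≤ 2^{2/3 + (2/2.37295)(1.58 − 2/3)} ≤ 2^{ℓ(2.37295)}`).  This moves the
route's hypothesis-free kernel rung from `4^{log₆ 3} = 2.3397` (item 28620) to `2.7`; TOP is the
same statement for every `c < 3`. [this route, g5] -/
theorem cwTwoRate_of_le_twoPointSeven {c : ℝ} (hc0 : 0 ≤ c) (hc : c ≤ 2.7) (N₀ : ℕ) :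
    ∃ N : ℕ, N₀ ≤ N ∧ ∃ n : ℕ,
      TensorRestrictsTo (kroneckerPow (cwTensor ℂ 2) N) (matMulTensor ℂ n n n) ∧
        c ^ N ≤ (n : ℝ) ^ 2 := by
  refine cwTwoRate_leGall hc0 (hc.trans_lt (twoPointSeven_lt_two_rpow.trans_le
    (Real.rpow_le_rpow_of_exponent_le one_le_two ?_))) N₀
  linarith [logb_two_three_ge]

/-! ## The two hypothesis-free rungs, BY NAME (items 28972, 28973) -/

/-- **Item `CwTwoRateLeGall` (stmt-MatrixMultiplication-28972), BY NAME**: the laser-merge rung for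
every `0 ≤ c < 2^{ℓ(2.37295)}`, hypothesis-free. [cite: LeGall2014, Table 2] -/
theorem cwTwoRateLeGall_holds :
    Summit.MatrixMultiplication.MatrixMultiplication.Theses.OutsiderSandwich.CwTwoRateLeGall :=
  fun _c hc0 hc N₀ => cwTwoRate_leGall hc0 hc N₀

/-- **Item `CwTwoRateTwoPointSeven` (stmt-MatrixMultiplication-28973), BY NAME**: the decimal rung
`c ≤ 2.7`, hypothesis-free. [this route, g5] -/
theorem cwTwoRateTwoPointSeven_holds :
    Summit.MatrixMultiplication.MatrixMultiplication.Theses.OutsiderSandwich.CwTwoRateTwoPointSeven :=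
  fun _c hc0 hc N₀ => cwTwoRate_of_le_twoPointSeven hc0 hc N₀

end Summit.MatrixMultiplication.MatrixMultiplication.Theorems.OutsiderSandwichLaserMerge
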